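import Summits.MatrixMultiplication.MatrixMultiplication.Theorems.EdgePencilSixth

/-!
# The half-tensor `X_N^{(e,d)}` of the sixth-edge rung and its mirror `σX`

Support kernel (1/3) for `stmt-MatrixMultiplication-26697` (`TetraExcessZero : ω(K₄) ≤ ω(2,1,2)`,
the attacked leaf of route `TetrahedronCarving`; lineage `decomp-mm-lens-6` «barrier-complement
carving», generation 31, memo NODE-g31 §2), rung side `stub_sixRungPos : ∃ δ > 0, χ(δ) ≤ ψ` of the
registered skeleton `Cruxes/TetraExcessZero/Lines/rung_and_chord` (`χ = omegaSix`, `ψ = ω(2,1,2)`).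
The three files `EdgePencilHalfTetra` (object), `EdgePencilPairing` (the pairing
`R₄(W_N^{(e²)}) ≤ R₄(X)·R₄(σX)`), `EdgePencilHalfFloor` (the un-pairing floor `N²e ≤ R₄(X)` and the
by-name corollary «an un-paired rung certificate refutes `ω = 2`») type, in proved currency, the
object named by the critic's trap T7 (decomp-mm STATUS l.1427/1428: «any rung/pairing inequality must
use structure NOT expressible as a one-edge weight — the entangled two-edge σ-pair of NODE-g26 §2
I-R1, or a genuinely 4-party spectral point») — the σ-PAIR — which NODE-g26 left as a sorried
sketch. No item is added or changed.

THE OBJECT (§1). Inside the cubic format of `T(K₄)_N` (`TetrahedronTensorCore`; slots: party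
`0 ↦ (01,02,03)`, `1 ↦ (01,12,13)`, `2 ↦ (02,12,23)`, `3 ↦ (03,13,23)`):
* the HALF-TENSOR `X = X_N^{(e,d)} = halfTetra F N e d`: the triangle `023` (edges `02, 03` at bond
  `N`, edge `23` thinned to bond `d`) plus the PENDANT edge `01` at bond `e`; the edges `12, 13` are
  deleted (bond `1`), so party `1` holds only its end of the pendant — a paw-shaped `K₄`-graph tensor
  with bond profile `(01,02,03,12,13,23) = (e, N, N, 1, 1, d)`;
* its MIRROR `σX = halfTetraMirror F N e d` (`σ = (0 1)`): triangle `123` plus the pendant `01`,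
  edges `02, 03` deleted — profile `(e, 1, 1, N, N, d)`.
Both are leg-restrictions of `T(K₄)_N` (`tensorRankD_halfTetra_le_tetra`).

MIRROR SYMMETRY (§2). `σX` is the pullback of `X` along the vertex swap `0 ↔ 1` with the induced
slot swaps at vertices `2, 3` (`halfTetraMirror_eq_pullback`), whence `R₄(σX) ≤ R₄(X)`
(`tensorRankD_halfTetraMirror_le`, by permuting the legs of an optimal decomposition).

References: Christandl–Vrana–Zuiddam [ChristandlVranaZuiddam2016] (arXiv:1609.07476) Ex. 1.1.2, §1.1
(graph tensors with non-uniform bonds multiply edge-wise under `⊠`; restriction), §1.2 eq. (flat)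
(flattening lower bounds), Prop. 1.1.16 (proof); Bürgisser–Clausen–Shokrollahi
[BurgisserClausenShokrollahi1997] §14.4 (flattenings / substitution lower bounds); Le Gall [LeGall2012]
§1 (`ω(1,1,½) = 2 ⟺ α ≥ 1/2`). No `sorry`, no new axiom, no instance, no notation.
-/

noncomputable section

set_option linter.dupNamespace false

open Finset Filter Asymptotics Literature.Computability.AlgebraicComplexity
open Summit.MatrixMultiplication.MatrixMultiplication.Theorems.TetrahedronTensor
open Summit.MatrixMultiplication.MatrixMultiplication.Theorems.TetraDiagonal
open Summit.MatrixMultiplication.MatrixMultiplication.Theses.TetrahedronCarving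

namespace Summit.MatrixMultiplication.MatrixMultiplication.Theorems.EdgePencil

/-! ## §1 The half-tensor `X_N^{(e,d)}` and its mirror `σX` -/

section Half

variable (F : Type*) [Field F]

/-- The legs of `X_N^{(e,d)}`: vertex `0` tests its slot `0` (edge `01`) for `< e`; vertex `1` tests
its slots `1, 2` (edges `12, 13`) for `< 1` (deleted edges); vertex `2` tests its slot `2` (edge `23`)
for `< d`. -/
def halfLegs (N e d : ℕ) : Fin 4 → Fin (N ^ 3) → F :=
  ![thinInd F N e 0, fun x => thinInd F N 1 1 x * thinInd F N 1 2 x, thinInd F N d 2, fun _ => 1]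

/-- **The half-tensor `X_N^{(e,d)}`**: triangle `023` (bonds `02 = 03 = N`, `23 = d`) plus the pendant
edge `01` at bond `e`, edges `12, 13` deleted; inside the format of `T(K₄)_N`.
(CVZ19 Ex. 1.1.2 with a non-uniform dimension function; NODE-g26 §2 I-R1.) -/
def halfTetra (N e d : ℕ) : (Fin 4 → Fin (N ^ 3)) → F :=
  fun i => thinInd F N e 0 (i 0) * (thinInd F N 1 1 (i 1) * thinInd F N 1 2 (i 1)) *
    thinInd F N d 2 (i 2) * tetra F N i

/-- The legs of the mirror `σX_N^{(e,d)}`: vertex `0` tests its slot `0` (edge `01`) for `< e` and its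
slots `1, 2` (edges `02, 03`) for `< 1`; vertex `2` tests its slot `2` (edge `23`) for `< d`. -/
def halfMirrorLegs (N e d : ℕ) : Fin 4 → Fin (N ^ 3) → F :=
  ![fun x => thinInd F N e 0 x * (thinInd F N 1 1 x * thinInd F N 1 2 x), fun _ => 1,
    thinInd F N d 2, fun _ => 1]

/-- **The mirror half-tensor `σX_N^{(e,d)}`** (`σ = (0 1)`): triangle `123` (bonds `12 = 13 = N`,
`23 = d`) plus the pendant `01` at bond `e`, edges `02, 03` deleted. (NODE-g26 §2 I-R1.) -/
def halfTetraMirror (N e d : ℕ) : (Fin 4 → Fin (N ^ 3)) → F :=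
  fun i => thinInd F N e 0 (i 0) * (thinInd F N 1 1 (i 0) * thinInd F N 1 2 (i 0)) *
    thinInd F N d 2 (i 2) * tetra F N i

variable {F}

/-- The leg product of `halfLegs`. -/
theorem prod_halfLegs {N e d : ℕ} (i : Fin 4 → Fin (N ^ 3)) :
    ∏ v, halfLegs F N e d v (i v) =
      thinInd F N e 0 (i 0) * (thinInd F N 1 1 (i 1) * thinInd F N 1 2 (i 1)) *
        thinInd F N d 2 (i 2) := by
  rw [Fin.prod_univ_four]
  simp [halfLegs]

/-- The leg product of `halfMirrorLegs`. -/
theorem prod_halfMirrorLegs {N e d : ℕ} (i : Fin 4 → Fin (N ^ 3)) :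
    ∏ v, halfMirrorLegs F N e d v (i v) =
      thinInd F N e 0 (i 0) * (thinInd F N 1 1 (i 0) * thinInd F N 1 2 (i 0)) *
        thinInd F N d 2 (i 2) := by
  rw [Fin.prod_univ_four]
  simp [halfMirrorLegs]

/-- `X` is a leg-restriction of `T(K₄)_N`. -/
theorem halfTetra_eq_legMul (N e d : ℕ) :
    halfTetra F N e d = fun i => (∏ v, halfLegs F N e d v (i v)) * tetra F N i := by
  funext i
  rw [prod_halfLegs, halfTetra]

/-- `σX` is a leg-restriction of `T(K₄)_N`. -/
theorem halfTetraMirror_eq_legMul (N e d : ℕ) :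
    halfTetraMirror F N e d = fun i => (∏ v, halfMirrorLegs F N e d v (i v)) * tetra F N i := by
  funext i
  rw [prod_halfMirrorLegs, halfTetraMirror]

/-- **`R₄(X) ≤ R₄(T(K₄)_N)`** (restriction). [folklore] -/
theorem tensorRankD_halfTetra_le_tetra (N e d : ℕ) :
    tensorRankD (halfTetra F N e d) ≤ tensorRankD (tetra F N) := by
  rw [halfTetra_eq_legMul (F := F) N e d]
  exact tensorRankD_legMul_le _ _ (tetra_decomposable N)

/-- **`R₄(σX) ≤ R₄(T(K₄)_N)`** (restriction). [folklore] -/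
theorem tensorRankD_halfTetraMirror_le_tetra (N e d : ℕ) :
    tensorRankD (halfTetraMirror F N e d) ≤ tensorRankD (tetra F N) := by
  rw [halfTetraMirror_eq_legMul (F := F) N e d]
  exact tensorRankD_legMul_le _ _ (tetra_decomposable N)

/-- `X` decomposes over rank-one tensors. -/
theorem halfTetra_decomposable (N e d : ℕ) :
    ∃ s : ℕ, ∃ g : Fin s → ((Fin 4 → Fin (N ^ 3)) → F),
      (∀ k, g k ∈ rankOneTensors F (N ^ 3) 4) ∧ ∑ k, g k = halfTetra F N e d := by
  rw [halfTetra_eq_legMul (F := F) N e d]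
  exact legMul_decomposable (tetra F N) (halfLegs F N e d) (tetra_decomposable N)

/-- `σX` decomposes over rank-one tensors. -/
theorem halfTetraMirror_decomposable (N e d : ℕ) :
    ∃ s : ℕ, ∃ g : Fin s → ((Fin 4 → Fin (N ^ 3)) → F),
      (∀ k, g k ∈ rankOneTensors F (N ^ 3) 4) ∧ ∑ k, g k = halfTetraMirror F N e d := by
  rw [halfTetraMirror_eq_legMul (F := F) N e d]
  exact legMul_decomposable (tetra F N) (halfMirrorLegs F N e d) (tetra_decomposable N)

/-- A rank-one decomposition of `X` of length exactly `R₄(X)`. [folklore] -/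
theorem exists_rankOne_decomposition_halfTetra (N e d : ℕ) :
    ∃ u : Fin (tensorRankD (halfTetra F N e d)) → Fin 4 → Fin (N ^ 3) → F,
      ∑ k, rankOneTensor (u k) = halfTetra F N e d := by
  classical
  obtain ⟨g, hg, hs⟩ := sComplexity_spec (halfTetra_decomposable (F := F) N e d)
  simp only [rankOneTensors, Set.mem_range] at hg
  choose u hu using hg
  have h : ∑ k, rankOneTensor (u k) = ∑ k, g k := Finset.sum_congr rfl fun k _ => hu k
  exact ⟨u, h.trans hs⟩

/-- A rank-one decomposition of `σX` of length exactly `R₄(σX)`. [folklore] -/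
theorem exists_rankOne_decomposition_halfTetraMirror (N e d : ℕ) :
    ∃ u : Fin (tensorRankD (halfTetraMirror F N e d)) → Fin 4 → Fin (N ^ 3) → F,
      ∑ k, rankOneTensor (u k) = halfTetraMirror F N e d := by
  classical
  obtain ⟨g, hg, hs⟩ := sComplexity_spec (halfTetraMirror_decomposable (F := F) N e d)
  simp only [rankOneTensors, Set.mem_range] at hg
  choose u hu using hg
  have h : ∑ k, rankOneTensor (u k) = ∑ k, g k := Finset.sum_congr rfl fun k _ => hu k
  exact ⟨u, h.trans hs⟩

end Half

/-! ## §2 Mirror symmetry: `σX` is the pullback of `X` along the vertex swap `0 ↔ 1` -/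

section Mirror

variable {F : Type*} [Field F]

/-- Swap the slots `0` and `1` of a leg index (at vertices `2` and `3` the vertex swap `0 ↔ 1`
exchanges the edges `02 ↔ 12`, resp. `03 ↔ 13`, which sit in slots `0, 1`). -/
def slotSwap {N : ℕ} (x : Fin (N ^ 3)) : Fin (N ^ 3) :=
  finFunctionFinEquiv fun j => finFunctionFinEquiv.symm x (Equiv.swap (0 : Fin 3) 1 j)

/-- The leg map of the mirror: vertices `0 ↔ 1` exchanged, slots `0 ↔ 1` swapped at vertices `2, 3`. -/
def mirrorPull {N : ℕ} (i : Fin 4 → Fin (N ^ 3)) : Fin 4 → Fin (N ^ 3) :=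
  ![i 1, i 0, slotSwap (i 2), slotSwap (i 3)]

/-- Slots of a slot-swapped leg index. -/
theorem symm_slotSwap {N : ℕ} (x : Fin (N ^ 3)) (j : Fin 3) :
    finFunctionFinEquiv.symm (slotSwap x) j = finFunctionFinEquiv.symm x (Equiv.swap (0 : Fin 3) 1 j) := by
  simp only [slotSwap, Equiv.symm_apply_apply]

/-- The tetrahedron tensor is invariant under the mirror leg map (the vertex swap `0 ↔ 1` is an
automorphism of `K₄`; consistency of the label triples is permuted, not changed). [folklore] -/
theorem tetra_mirrorPull {N : ℕ} (i : Fin 4 → Fin (N ^ 3)) :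
    tetra F N (mirrorPull i) = tetra F N i := by
  simp only [tetra]
  refine if_congr ?_ rfl rfl
  simp only [consistent_iff, mirrorPull, Matrix.cons_val_zero, Matrix.cons_val_one,
    Matrix.cons_val_two, Matrix.cons_val_three, Matrix.head_cons, Matrix.tail_cons, symm_slotSwap,
    Equiv.swap_apply_left, Equiv.swap_apply_right,
    Equiv.swap_apply_of_ne_of_ne (show (2 : Fin 3) ≠ 0 by decide) (show (2 : Fin 3) ≠ 1 by decide)]
  constructor
  · rintro ⟨h₁, h₂, h₃, h₄, h₅, h₆⟩
    exact ⟨h₁.symm, h₄, h₅, h₂, h₃, h₆⟩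
  · rintro ⟨h₁, h₂, h₃, h₄, h₅, h₆⟩
    exact ⟨h₁.symm, h₄, h₅, h₂, h₃, h₆⟩

/-- The mirror leg map on vertex `0`. -/
theorem mirrorPull_zero {N : ℕ} (i : Fin 4 → Fin (N ^ 3)) : mirrorPull i 0 = i 1 := rfl

/-- The mirror leg map on vertex `1`. -/
theorem mirrorPull_one {N : ℕ} (i : Fin 4 → Fin (N ^ 3)) : mirrorPull i 1 = i 0 := rfl

/-- The mirror leg map on vertex `2`. -/
theorem mirrorPull_two {N : ℕ} (i : Fin 4 → Fin (N ^ 3)) : mirrorPull i 2 = slotSwap (i 2) := rfl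

/-- The slot-`2` test is blind to the swap of slots `0, 1`. -/
theorem thinInd_two_slotSwap {N d : ℕ} (x : Fin (N ^ 3)) :
    thinInd F N d 2 (slotSwap x) = thinInd F N d 2 x := by
  simp only [thinInd, symm_slotSwap,
    Equiv.swap_apply_of_ne_of_ne (show (2 : Fin 3) ≠ 0 by decide) (show (2 : Fin 3) ≠ 1 by decide)]

/-- **`σX = X ∘ mirror`** pointwise: at a consistent point both ends of the pendant carry the same
label, so testing the pendant at vertex `0` (as `σX` does) or at the image of vertex `1` (as the
pullback of `X` does) agrees; at an inconsistent point both sides vanish. [folklore] -/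
theorem halfTetraMirror_eq_pullback (N e d : ℕ) :
    halfTetraMirror F N e d = fun i => halfTetra F N e d (mirrorPull i) := by
  funext i
  simp only [halfTetraMirror, halfTetra, mirrorPull_zero, mirrorPull_one, mirrorPull_two,
    thinInd_two_slotSwap, tetra_mirrorPull]
  by_cases hc : consistent (fun v => (finFunctionFinEquiv.symm (i v) : Fin 3 → Fin N)) = true
  · -- consistent: the pendant labels at vertices `0` and `1` agree
    have h01 : finFunctionFinEquiv.symm (i 0) 0 = finFunctionFinEquiv.symm (i 1) 0 :=
      ((consistent_iff _).1 hc).1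
    have h01' : thinInd F N e 0 (i 0) = thinInd F N e 0 (i 1) := by
      simp only [thinInd, h01]
    rw [h01']
  · have h0 : tetra F N i = 0 := by
      simp only [tetra, if_neg hc]
    simp only [h0, mul_zero]

/-- A decomposition of `σX` of length `R₄(X)`: the legs of an optimal decomposition of `X`,
permuted by the mirror (vertices `0 ↔ 1`, slots `0 ↔ 1` at vertices `2, 3`). [folklore] -/
theorem exists_rankOne_decomposition_mirror (N e d : ℕ) :
    ∃ u : Fin (tensorRankD (halfTetra F N e d)) → Fin 4 → Fin (N ^ 3) → F,
      ∑ k, rankOneTensor (u k) = halfTetraMirror F N e d := by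
  classical
  obtain ⟨u, hu⟩ := exists_rankOne_decomposition_halfTetra (F := F) N e d
  refine ⟨fun k => ![u k 1, u k 0, fun x => u k 2 (slotSwap x), fun x => u k 3 (slotSwap x)], ?_⟩
  funext i
  have hi := congrFun hu (mirrorPull i)
  rw [Finset.sum_apply] at hi
  have hp : halfTetraMirror F N e d i = halfTetra F N e d (mirrorPull i) :=
    congrFun (halfTetraMirror_eq_pullback (F := F) N e d) i
  rw [Finset.sum_apply, hp, ← hi]
  refine Finset.sum_congr rfl fun k _ => ?_
  simp only [rankOneTensor_apply, Fin.prod_univ_four, mirrorPull, Matrix.cons_val_zero,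
    Matrix.cons_val_one, Matrix.cons_val_two, Matrix.cons_val_three, Matrix.head_cons,
    Matrix.tail_cons]
  ring

/-- **`R₄(σX) ≤ R₄(X)`** (the mirror is a relabelling). [folklore] -/
theorem tensorRankD_halfTetraMirror_le (N e d : ℕ) :
    tensorRankD (halfTetraMirror F N e d) ≤ tensorRankD (halfTetra F N e d) := by
  obtain ⟨u, hu⟩ := exists_rankOne_decomposition_mirror (F := F) N e d
  exact tensorRankD_le_of_eq_sum u hu

end Mirror

end Summit.MatrixMultiplication.MatrixMultiplication.Theorems.EdgePencil

end
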